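import Summits.Ventures.LatticeQCDFlow.TrivializingMaps.WitnessVarianceFloor

/-!
HONEST FRAMING: exact (Metropolis-corrected) sampling algorithms for lattice gauge theory; figures
of merit are autocorrelation/cost numbers at stated couplings and volumes; no continuum-physics
claim.

# ExtensiveSpecificHeatHeatBath — THE ONE-LINK HAAR AVERAGE `A_e` AND THE HEAT-BATH KERNEL `K_e` OF THE
# WILSON MEASURE (theory2 item 126, PART 1 of 4: §1–§2)

CUSTODY: theory2 item 126 (GEN-39, HOME tier) re-landed by lean-2 GEN-9 per LEAD LINE 245 RT-30 (202);
statements and proofs = HOME/lean/theory2/ExtensiveSpecificHeat.lean 21be0330075c0491 (1 051 l) verbatim,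
split below the `lint.size` line into FOUR files (`…HeatBath` §1–§2, `…Innovations` §3–§4, `…Staple`
§5–§6, `ExtensiveSpecificHeat` §7); headers trimmed; landing edits: docstrings added where the lint asks.

THEORY-2 item 126 (theory2 GEN-39; cell pub-lqcd / Ventures/LatticeQCDFlow).  Main theorem of the series
(`ExtensiveSpecificHeat.wilson_variance_ge_extensive`, PART 4): on the torus `(ℤ/L)^{n+2}`, `L ≥ 2`, for
every compact second-countable Hausdorff-Borel group `G`, every continuous representation
`ρ : G →* Matrix (Fin N) (Fin N) ℂ` and EVERY real `β`,
`L·⌊L/2⌋^{n+1} · exp(−8N(n+1)|β|) · Var_Haar(Re tr ρ) ≤ Var_{π_β}(S_W)` (Dobrushin–Tirozzi sublattice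
conditioning, no expansion).  This part: §1 the one-link Haar average `A_e f (U) = ∫_G f(h ·ₑ U) dh`
(`linkAvg`), its invariance / Fubini / self-adjointness properties under `D[U]`; §2 the Wilson density
`wDens`, the one-link heat-bath operator `hb β e` (conditional expectation given the other links) and its
orthogonality relations under `π_β`.
-/

noncomputable section

set_option linter.unusedSectionVars false

namespace Summit.Ventures.LatticeQCDFlow.Theory2.ExtensiveSpecificHeat

open MeasureTheory ProbabilityTheory Literature.MathematicalPhysics.QuantumFieldTheory
open Summit.Ventures.LatticeQCDFlow.TrivializingMaps
open scoped ENNReal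

/-! ## §1 The one-link Haar average `A_e f (U) = ∫_G f(h ·ₑ U) dh` -/

section LinkAvg

variable {d L N : ℕ} [NeZero L] {G : Type*} [Group G] [TopologicalSpace G] [IsTopologicalGroup G]
  [CompactSpace G] [MeasurableSpace G] [BorelSpace G] [SecondCountableTopology G]
  [DecidableEq (Edge d L)]

/-- The one-link Haar average `A_e f (U) = ∫_G f(h ·ₑ U) dh` (the conditional expectation of `f`
given all links but `e` under PRODUCT Haar). -/
def linkAvg (e : Edge d L) (f : GaugeConfig d L G → ℝ) (U : GaugeConfig d L G) : ℝ :=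
  ∫ h, f (Pi.mulSingle e h * U) ∂haarProbability G

/-- Two successive left multiplications of the same link. -/
theorem mulSingle_mul_mulSingle_mul (e : Edge d L) (h h' : G) (U : GaugeConfig d L G) :
    Pi.mulSingle e h' * (Pi.mulSingle e h * U) = Pi.mulSingle e (h' * h) * U := by
  funext x
  simp only [Pi.mul_apply, Pi.mulSingle_apply]
  split_ifs with hx
  · rw [mul_assoc]
  · simp only [one_mul]

/-- Left multiplications of two different links commute. -/
theorem mulSingle_comm_mul {e e' : Edge d L} (hne : e ≠ e') (h h' : G) (U : GaugeConfig d L G) :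
    Pi.mulSingle e h * (Pi.mulSingle e' h' * U) = Pi.mulSingle e' h' * (Pi.mulSingle e h * U) := by
  funext x
  simp only [Pi.mul_apply, Pi.mulSingle_apply]
  split_ifs with h1 h2
  · exact absurd (h1.symm.trans h2) hne
  · simp only [one_mul]
  · simp only [one_mul]
  · rfl

/-- `1 ·ₑ U = U`. -/
theorem mulSingle_one_mul (e : Edge d L) (U : GaugeConfig d L G) :
    Pi.mulSingle e (1 : G) * U = U := by
  funext x
  simp only [Pi.mul_apply, Pi.mulSingle_apply]
  split_ifs <;> simp only [one_mul]

/-- `A_e f` does not depend on the link `e` (right invariance of Haar). -/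
theorem linkAvg_mulSingle (e : Edge d L) (f : GaugeConfig d L G → ℝ) (h : G)
    (U : GaugeConfig d L G) : linkAvg e f (Pi.mulSingle e h * U) = linkAvg e f U := by
  unfold linkAvg
  simp_rw [mulSingle_mul_mulSingle_mul]
  exact integral_mul_right_eq_self (μ := haarProbability G)
    (fun h' => f (Pi.mulSingle e h' * U)) h

/-- Joint continuity of `(U, h) ↦ f (h ·ₑ U)`. -/
theorem continuous_comp_mulSingle (e : Edge d L) {f : GaugeConfig d L G → ℝ} (hf : Continuous f) :
    Continuous fun p : GaugeConfig d L G × G => f (Pi.mulSingle e p.2 * p.1) :=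
  hf.comp (((continuous_mulSingle e).comp continuous_snd).mul continuous_fst)

/-- Continuity of the fibre map `h ↦ h ·ₑ U`. -/
theorem continuous_mulSingle_mul (e : Edge d L) (U : GaugeConfig d L G) :
    Continuous fun h : G => Pi.mulSingle e h * U :=
  (continuous_mulSingle (A := fun _ : Edge d L => G) e).mul continuous_const

/-- `A_e f` is continuous for continuous `f` (parametric integral over the compact group). -/
theorem continuous_linkAvg (e : Edge d L) {f : GaugeConfig d L G → ℝ} (hf : Continuous f) :
    Continuous (linkAvg (G := G) e f) := by
  have hF : Continuous (Function.uncurry fun (U : GaugeConfig d L G) (h : G) =>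
      f (Pi.mulSingle e h * U)) := continuous_comp_mulSingle e hf
  have h := continuous_parametric_integral_of_continuous (μ := haarProbability G) hF
    isCompact_univ
  simp only [Measure.restrict_univ] at h
  exact h

/-- A continuous function on the (compact) group is integrable for every finite measure. -/
theorem integrable_of_continuous_group {μ : Measure G} [IsFiniteMeasure μ]
    {φ : G → ℝ} (hφ : Continuous φ) : Integrable φ μ :=
  hφ.integrable_of_hasCompactSupport (HasCompactSupport.of_compactSpace _)

/-- A continuous function on the compact configuration space is integrable (finite measures). -/
theorem integrable_of_continuous_config {μ : Measure (GaugeConfig d L G)} [IsFiniteMeasure μ]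
    {f : GaugeConfig d L G → ℝ} (hf : Continuous f) : Integrable f μ :=
  hf.integrable_of_hasCompactSupport (HasCompactSupport.of_compactSpace _)

/-- **`∫ A_e f dU = ∫ f dU`** for product Haar `dU` (Fubini and left invariance of `dU` under
`U ↦ h ·ₑ U`). -/
theorem integral_linkAvg (e : Edge d L) {f : GaugeConfig d L G → ℝ} (hf : Continuous f) :
    ∫ U, linkAvg e f U ∂Measure.pi (fun _ : Edge d L => haarProbability G)
      = ∫ U, f U ∂Measure.pi (fun _ : Edge d L => haarProbability G) := by
  set π := Measure.pi (fun _ : Edge d L => haarProbability G) with hπ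
  have hint : Integrable (Function.uncurry fun (U : GaugeConfig d L G) (h : G) =>
      f (Pi.mulSingle e h * U)) (π.prod (haarProbability G)) :=
    (continuous_comp_mulSingle e hf).integrable_of_hasCompactSupport
      (HasCompactSupport.of_compactSpace _)
  unfold linkAvg
  rw [integral_integral_swap hint]
  have hinv : ∀ h : G, ∫ U, f (Pi.mulSingle e h * U) ∂π = ∫ U, f U ∂π := fun h =>
    integral_mul_left_eq_self (μ := π) f (Pi.mulSingle e h)
  simp_rw [hinv]
  rw [integral_const, smul_eq_mul, probReal_univ, one_mul]

/-- Factors not depending on the link `e` come out of `A_e`. -/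
theorem linkAvg_mul_left (e : Edge d L) {g f : GaugeConfig d L G → ℝ}
    (hg : ∀ (h : G) (U : GaugeConfig d L G), g (Pi.mulSingle e h * U) = g U)
    (U : GaugeConfig d L G) :
    linkAvg e (fun V => g V * f V) U = g U * linkAvg e f U := by
  unfold linkAvg
  simp_rw [hg]
  exact integral_const_mul _ _

end LinkAvg

/-! ## §2 The one-link heat-bath operator `K_e` of the Wilson measure and its orthogonality -/

section HeatBath

variable {d L N : ℕ} [NeZero L] {G : Type*} [Group G] [TopologicalSpace G] [IsTopologicalGroup G]
  [CompactSpace G] [MeasurableSpace G] [BorelSpace G] [SecondCountableTopology G]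
  [DecidableEq (Edge d L)] (ρ : G →* Matrix (Fin N) (Fin N) ℂ)

/-- The Wilson density `w_β(U) = e^{-β S(U)}`. -/
def wDens (β : ℝ) (U : GaugeConfig d L G) : ℝ := Real.exp (-β * wilsonAction ρ U)

/-- **The one-link heat-bath operator** `K_e f (U) = ∫ f(h ·ₑ U) w_β(h ·ₑ U) dh / ∫ w_β(h ·ₑ U) dh`:
the conditional expectation of `f` given all links but `e` under the Wilson measure `π_β`. -/
def hb (β : ℝ) (e : Edge d L) (f : GaugeConfig d L G → ℝ) (U : GaugeConfig d L G) : ℝ :=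
  linkAvg e (fun V => f V * wDens ρ β V) U / linkAvg e (wDens ρ β) U

/-- The Wilson action is continuous (continuous `ρ`). -/
theorem continuous_wilsonAction' (hρ : Continuous ρ) :
    Continuous (wilsonAction (d := d) (L := L) (G := G) ρ) := by
  unfold wilsonAction
  refine continuous_finsetSum _ fun p _ => continuous_const.sub ?_
  have h1 : Continuous fun U : GaugeConfig d L G => plaquetteHolonomy U p.1 p.2.1.1 p.2.1.2 := by
    unfold plaquetteHolonomy; fun_prop
  exact Complex.continuous_re.comp (hρ.comp h1).matrix_trace

/-- The Wilson density is continuous. -/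
theorem continuous_wDens (hρ : Continuous ρ) (β : ℝ) :
    Continuous (wDens (d := d) (L := L) (G := G) ρ β) :=
  Real.continuous_exp.comp (continuous_const.mul (continuous_wilsonAction' ρ hρ))

/-- The Wilson density is positive. -/
theorem wDens_pos (β : ℝ) (U : GaugeConfig d L G) : 0 < wDens ρ β U := Real.exp_pos _

/-- `A_e w_β > 0`. -/
theorem linkAvg_wDens_pos (hρ : Continuous ρ) (β : ℝ) (e : Edge d L) (U : GaugeConfig d L G) :
    0 < linkAvg e (wDens ρ β) U := by
  unfold linkAvg wDens
  have hc : Continuous fun h : G => -β * wilsonAction ρ (Pi.mulSingle e h * U) :=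
    continuous_const.mul ((continuous_wilsonAction' ρ hρ).comp (continuous_mulSingle_mul e U))
  exact integral_exp_pos (integrable_of_continuous_group (Real.continuous_exp.comp hc))

/-- `K_e f` does not depend on the link `e`. -/
theorem hb_mulSingle (β : ℝ) (e : Edge d L) (f : GaugeConfig d L G → ℝ) (h : G)
    (U : GaugeConfig d L G) : hb ρ β e f (Pi.mulSingle e h * U) = hb ρ β e f U := by
  unfold hb
  rw [linkAvg_mulSingle, linkAvg_mulSingle]

/-- `K_e f` is continuous for continuous `f`. -/
theorem continuous_hb (hρ : Continuous ρ) (β : ℝ) (e : Edge d L) {f : GaugeConfig d L G → ℝ}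
    (hf : Continuous f) : Continuous (hb ρ β e f) :=
  (continuous_linkAvg e (hf.mul (continuous_wDens ρ hρ β))).div
    (continuous_linkAvg e (continuous_wDens ρ hρ β)) fun U => (linkAvg_wDens_pos ρ hρ β e U).ne'

/-- Wilson expectations are product-Haar integrals against the density, up to the factor `Z⁻¹`. -/
theorem integral_wilsonMeasure_eq_mul (hρ : Continuous ρ) (β : ℝ) (φ : GaugeConfig d L G → ℝ) :
    ∫ U, φ U ∂wilsonMeasure ρ β
      = ((partitionFunction (d := d) (L := L) ρ β)⁻¹).toReal
          * ∫ U, wDens ρ β U * φ U ∂Measure.pi (fun _ : Edge d L => haarProbability G) := by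
  simp only [wilsonMeasure, integral_smul_measure, smul_eq_mul]
  congr 1
  unfold wilsonWeight
  rw [integral_withDensity_eq_integral_toReal_smul (WitnessColumn.measurable_wilsonDensity ρ hρ β)
    (ae_of_all _ fun _ => ENNReal.ofReal_lt_top)]
  refine integral_congr_ae (ae_of_all _ fun U => ?_)
  simp only [wDens, smul_eq_mul, ENNReal.toReal_ofReal (Real.exp_pos _).le]

/-- **ORTHOGONALITY of the heat-bath innovation.** For continuous `f, g` with `g` not depending on
the link `e`: `∫ (f - K_e f) · g dπ_β = 0`. -/
theorem integral_sub_hb_mul_eq_zero (hρ : Continuous ρ) (β : ℝ) (e : Edge d L)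
    {f g : GaugeConfig d L G → ℝ} (hf : Continuous f) (hg : Continuous g)
    (hginv : ∀ (h : G) (U : GaugeConfig d L G), g (Pi.mulSingle e h * U) = g U) :
    ∫ U, (f U - hb ρ β e f U) * g U ∂wilsonMeasure ρ β = 0 := by
  rw [integral_wilsonMeasure_eq_mul ρ hρ β]
  refine mul_eq_zero_of_right _ ?_
  have hw : Continuous (wDens (d := d) (L := L) ρ β) := continuous_wDens ρ hρ β
  have hK : Continuous (hb ρ β e f) := continuous_hb ρ hρ β e hf
  have h1 : ∫ U, wDens ρ β U * (f U * g U) ∂Measure.pi (fun _ : Edge d L => haarProbability G)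
      = ∫ U, g U * linkAvg e (fun V => f V * wDens ρ β V) U
          ∂Measure.pi (fun _ : Edge d L => haarProbability G) := by
    rw [← integral_linkAvg e (f := fun V => wDens ρ β V * (f V * g V)) (hw.mul (hf.mul hg))]
    refine integral_congr_ae (ae_of_all _ fun U => ?_)
    have : (fun V : GaugeConfig d L G => wDens ρ β V * (f V * g V))
        = fun V => g V * (f V * wDens ρ β V) := by
      funext V; ring
    rw [this, linkAvg_mul_left e hginv]
  have h2 : ∫ U, wDens ρ β U * (hb ρ β e f U * g U) ∂Measure.pi (fun _ : Edge d L => haarProbability G)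
      = ∫ U, g U * linkAvg e (fun V => f V * wDens ρ β V) U
          ∂Measure.pi (fun _ : Edge d L => haarProbability G) := by
    rw [← integral_linkAvg e (f := fun V => wDens ρ β V * (hb ρ β e f V * g V))
      (hw.mul (hK.mul hg))]
    refine integral_congr_ae (ae_of_all _ fun U => ?_)
    have hinv' : ∀ (h : G) (V : GaugeConfig d L G),
        hb ρ β e f (Pi.mulSingle e h * V) * g (Pi.mulSingle e h * V) = hb ρ β e f V * g V := by
      intro h V
      rw [hb_mulSingle, hginv]
    have : (fun V : GaugeConfig d L G => wDens ρ β V * (hb ρ β e f V * g V))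
        = fun V => (hb ρ β e f V * g V) * wDens ρ β V := by
      funext V; ring
    rw [this, linkAvg_mul_left e hinv']
    have hne := (linkAvg_wDens_pos ρ hρ β e U).ne'
    simp only [hb]
    field_simp
  have hi1 : Integrable (fun U => wDens ρ β U * (f U * g U))
      (Measure.pi (fun _ : Edge d L => haarProbability G)) :=
    integrable_of_continuous_config (hw.mul (hf.mul hg))
  have hi2 : Integrable (fun U => wDens ρ β U * (hb ρ β e f U * g U))
      (Measure.pi (fun _ : Edge d L => haarProbability G)) :=
    integrable_of_continuous_config (hw.mul (hK.mul hg))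
  calc ∫ U, wDens ρ β U * ((f U - hb ρ β e f U) * g U)
        ∂Measure.pi (fun _ : Edge d L => haarProbability G)
      = ∫ U, (wDens ρ β U * (f U * g U) - wDens ρ β U * (hb ρ β e f U * g U))
          ∂Measure.pi (fun _ : Edge d L => haarProbability G) := by
        refine integral_congr_ae (ae_of_all _ fun U => ?_); simp only; ring
    _ = ∫ U, wDens ρ β U * (f U * g U) ∂Measure.pi (fun _ : Edge d L => haarProbability G)
          - ∫ U, wDens ρ β U * (hb ρ β e f U * g U)
              ∂Measure.pi (fun _ : Edge d L => haarProbability G) := integral_sub hi1 hi2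
    _ = 0 := by rw [h1, h2, sub_self]

/-- **Shift rule.** If replacing `U` by `V` shifts the action by the same constant `δ` along the
whole `e`-fibre, then `K_e S (V) = K_e S (U) + δ`. -/
theorem hb_wilsonAction_eq_add (hρ : Continuous ρ) (β : ℝ) (e : Edge d L)
    {U V : GaugeConfig d L G} {δ : ℝ}
    (hS : ∀ h : G, wilsonAction ρ (Pi.mulSingle e h * V)
      = wilsonAction ρ (Pi.mulSingle e h * U) + δ) :
    hb ρ β e (wilsonAction ρ) V = hb ρ β e (wilsonAction ρ) U + δ := by
  unfold hb linkAvg wDens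
  simp_rw [hS]
  set S : G → ℝ := fun h => wilsonAction ρ (Pi.mulSingle e h * U) with hSdef
  have hSc : Continuous S := (continuous_wilsonAction' ρ hρ).comp (continuous_mulSingle_mul e U)
  have hwc : Continuous fun h => Real.exp (-β * S h) := Real.continuous_exp.comp (continuous_const.mul hSc)
  have hexp : ∀ h, Real.exp (-β * (S h + δ)) = Real.exp (-β * δ) * Real.exp (-β * S h) := by
    intro h; rw [← Real.exp_add]; ring_nf
  simp_rw [show ∀ h, wilsonAction ρ (Pi.mulSingle e h * U) = S h from fun h => rfl, hexp]
  have hI1 : Integrable (fun h => Real.exp (-β * S h)) (haarProbability G) :=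
    integrable_of_continuous_group hwc
  have hI2 : Integrable (fun h => S h * Real.exp (-β * S h)) (haarProbability G) :=
    integrable_of_continuous_group (hSc.mul hwc)
  have hpos : 0 < ∫ h, Real.exp (-β * S h) ∂haarProbability G := integral_exp_pos hI1
  have hc : 0 < Real.exp (-β * δ) := Real.exp_pos _
  have hnum : ∫ h, (S h + δ) * (Real.exp (-β * δ) * Real.exp (-β * S h)) ∂haarProbability G
      = Real.exp (-β * δ) * (∫ h, S h * Real.exp (-β * S h) ∂haarProbability G
          + δ * ∫ h, Real.exp (-β * S h) ∂haarProbability G) := by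
    have : (fun h => (S h + δ) * (Real.exp (-β * δ) * Real.exp (-β * S h)))
        = fun h => Real.exp (-β * δ) * (S h * Real.exp (-β * S h))
            + (Real.exp (-β * δ) * δ) * Real.exp (-β * S h) := by
      funext h; ring
    rw [this, integral_add (hI2.const_mul _) (hI1.const_mul _), integral_const_mul,
      integral_const_mul]
    ring
  rw [hnum, integral_const_mul, mul_div_mul_left _ _ hc.ne', add_div, mul_div_assoc, div_self hpos.ne',
    mul_one]

end HeatBath

end Summit.Ventures.LatticeQCDFlow.Theory2.ExtensiveSpecificHeat
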